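import Mathlib
import Summits.CriticalPhenomena.PercolationContinuityZ3.Theorems.PercNearOneGluingNoHeavyLowerTailHypergeomSums
import Summits.CriticalPhenomena.PercolationContinuityZ3.Theorems.PercNearOneGluingNoHeavyLowerTailTNKernels
import Summits.CriticalPhenomena.PercolationContinuityZ3.Theorems.PercNearOneGluingNoHeavyLowerTailBandTwoNeutralTN
import HarnessLib

/-!
# Quadratic-row kernels, III (neutral grabber): the `g = 1` theorems in the `₂F₁` vocabulary of `…LowerTailBandTwoHyp`

Support file for the Sahi / Conjecture-P programme of route `PercNearOneGluingNoHeavy`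
(`--supports stmt-CriticalPhenomena-4575`, prover prim-l12-p5 gen 44; proof note
`prim-l12-p5/PROOF-QB1-HYPERGEOMETRIC-g44.md` §3.3 (d)).  No definitions, no named facts, no sorries.

`…LowerTailBandTwoHyp.threeRay_below_tn` (g43) states the TN of the three-ray band with the hypergeometric level
sequences `Q_c(n) = ₂F₁(-θ,-n;c;g)` for `0 ≤ g < 1`.  At the NEUTRAL endpoint `g = 1` (q_B = 1), Chu–Vandermonde
(`hyp_one`: `₂F₁(a,-r;c;1) = (c-a)_r/(c)_r`, from the b-step of `…HypergeomSums`) turns each row of that band into a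
positive multiple (`hypOne_row_eq`, `hypOne_row_factor_pos`) of the polynomial band of `…LowerTailBandTwoNeutralTN`, so:

* `threeRay_typeII_tn_hypOne` — Type II (one copy below, one sub-neutral copy above B's ray) at `g = 1`;
* `threeRay_typeIII_tn_hypOne` — Type III (both copies below) at `g = 1`, the endpoint excluded by `threeRay_below_tn`.
-/

namespace Summit.CriticalPhenomena.PercolationContinuityZ3.Theorems

namespace BandTwoNeutral

open Finset Matrix
open scoped Nat

/-! ### The same statements in the `₂F₁` vocabulary of `…LowerTailBandTwoHyp` at `g = 1` (Chu–Vandermonde) -/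

section HypOne

variable (H : ℝ → ℝ → ℕ → ℝ)
  (hH : ∀ a c r, H a c r = ∑ k ∈ range (r + 1), (r.choose k : ℝ) * (-(1 : ℝ)) ^ k *
    ((∏ i ∈ range k, (a + i)) / (∏ i ∈ range k, (c + i))))
include hH

/-- **Chu–Vandermonde** in the kernel's vocabulary: `₂F₁(a, -r; c; 1) = (c-a)_r/(c)_r` (`c > 0`), by induction on `r`
from the b-step `c (H a c (r+1) - H a c r) = -a H (a+1) (c+1) r` of `…HypergeomSums`. -/
theorem hyp_one (r : ℕ) : ∀ (a c : ℝ), 0 < c →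
    H a c r = (∏ i ∈ range r, (c - a + i)) / ∏ i ∈ range r, (c + i) := by
  induction r with
  | zero => intro a c hc; rw [HypergeomCM.hyp_zero 1 H hH]; simp
  | succ r ih =>
    intro a c hc
    have hs := HypergeomCM.hyp_step 1 H hH a c hc r
    rw [ih a c hc, ih (a + 1) (c + 1) (by linarith)] at hs
    have hPc : 0 < ∏ i ∈ range r, (c + (i : ℝ)) := HypergeomCM.prod_pos_of_pos c hc r
    have hPc1 : 0 < ∏ i ∈ range r, (c + 1 + (i : ℝ)) := HypergeomCM.prod_pos_of_pos (c + 1) (by linarith) r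
    have e1 : ∏ i ∈ range r, (c + 1 - (a + 1) + (i : ℝ)) = ∏ i ∈ range r, (c - a + i) :=
      prod_congr rfl (fun i _ => by ring)
    rw [e1] at hs
    have e2 : (∏ i ∈ range r, (c + (i : ℝ))) * (c + r) = c * ∏ i ∈ range r, (c + 1 + i) := by
      rw [← HypergeomCM.prod_succ_shift c r, prod_range_succ]
    rw [prod_range_succ, prod_range_succ]
    have hcr : 0 < c + r := by positivity
    -- solve the b-step for H a c (r+1)
    have hX : H a c (r + 1) = (∏ i ∈ range r, (c - a + (i : ℝ))) / (∏ i ∈ range r, (c + (i : ℝ)))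
        - a * (∏ i ∈ range r, (c - a + (i : ℝ))) / (c * ∏ i ∈ range r, (c + 1 + (i : ℝ))) := by
      have hc0 : c ≠ 0 := hc.ne'
      field_simp
      field_simp at hs
      linear_combination hs
    rw [hX, ← e2]
    field_simp
    ring

/-- Positivity of the `g = 1` values: `H (-θ) c r = (c+θ)_r/(c)_r > 0` for `c > 0`, `θ ≥ 0`. -/
theorem hyp_one_pos (θ c : ℝ) (hθ : 0 ≤ θ) (hc : 0 < c) (r : ℕ) : 0 < H (-θ) c r := by
  rw [hyp_one H hH r (-θ) c hc]
  have e : ∏ i ∈ range r, (c - -θ + (i : ℝ)) = ∏ i ∈ range r, (c + θ + i) := prod_congr rfl (fun i _ => by ring)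
  rw [e]
  exact div_pos (HypergeomCM.prod_pos_of_pos (c + θ) (by linarith) r) (HypergeomCM.prod_pos_of_pos c hc r)

/-- The `g = 1` band of `…LowerTailBandTwoHyp` is, row by row, a positive multiple of the polynomial band (`p = m-1+θ`):
row factors `m(m-1)/(λ²p(p+1))`, `m/(λ²(p+1))` (rows 0, 1) and `(m+1+θ)_{n-2}/((m+1)_{n-2} λ²)` (rows `n ≥ 2`). -/
theorem hypOne_row_eq (θ m lam g₁ g₂ w₁ w₂ : ℝ) (hm : 1 < m) (hθ : 0 < θ) (hlam : 0 < lam) (n l : ℕ) :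
    ((g₁ * g₂ * (n : ℝ) * ((n : ℝ) - 1) * H (-θ) (m + 1) (n - 2) + m * (g₁ + g₂) * (n : ℝ) * H (-θ) m (n - 1)
          + m * (m - 1) * H (-θ) (m - 1) n) * ((n.choose l : ℕ) : ℝ)
        + ((n : ℝ) / lam * ((w₁ * g₂ + w₂ * g₁) * ((n : ℝ) - 1) * H (-θ) (m + 1) (n - 2)
          + m * (w₁ + w₂) * H (-θ) m (n - 1))) * (((n - 1).choose l : ℕ) : ℝ)
        + ((n : ℝ) * ((n : ℝ) - 1) / lam ^ 2 * (w₁ * w₂) * H (-θ) (m + 1) (n - 2)) * (((n - 2).choose l : ℕ) : ℝ))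
      = (if n = 0 then m * (m - 1) / (lam ^ 2 * (m - 1 + θ) * (m - 1 + θ + 1))
          else if n = 1 then m / (lam ^ 2 * (m - 1 + θ + 1))
          else (∏ i ∈ range (n - 2), (m + 1 + θ + (i : ℝ))) / ((∏ i ∈ range (n - 2), (m + 1 + (i : ℝ))) * lam ^ 2))
        * ((lam ^ 2 * (g₁ * g₂ * (n : ℝ) * ((n : ℝ) - 1) + (g₁ + g₂) * ((m - 1 + θ) + 1) * (n : ℝ)
              + (m - 1 + θ) * ((m - 1 + θ) + 1))) * ((n.choose l : ℕ) : ℝ)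
            + (lam * (n : ℝ) * ((w₁ * g₂ + w₂ * g₁) * ((n : ℝ) - 1) + (w₁ + w₂) * ((m - 1 + θ) + 1)))
              * (((n - 1).choose l : ℕ) : ℝ)
            + (w₁ * w₂ * (n : ℝ) * ((n : ℝ) - 1)) * (((n - 2).choose l : ℕ) : ℝ)) := by
  have hm0 : 0 < m := by linarith
  have hm1 : 0 < m - 1 := by linarith
  have hlam0 : lam ≠ 0 := hlam.ne'
  rcases Nat.lt_or_ge n 2 with hn | hn
  · interval_cases n
    · -- row 0
      rw [if_pos rfl]
      simp only [Nat.cast_zero, Nat.zero_sub, zero_mul, mul_zero, zero_div, zero_add, add_zero]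
      rw [HypergeomCM.hyp_zero 1 H hH]
      have h1 : (m - 1 + θ) ≠ 0 := by linarith
      have h2 : (m - 1 + θ + 1) ≠ 0 := by linarith
      field_simp
    · -- row 1
      rw [if_neg one_ne_zero, if_pos rfl]
      simp only [Nat.cast_one, sub_self, mul_zero, zero_mul, zero_add, zero_div, add_zero,
        show (1 - 2 : ℕ) = 0 from rfl]
      rw [HypergeomCM.hyp_zero 1 H hH, hyp_one H hH 1 (-θ) (m - 1) hm1]
      simp only [prod_range_one, Nat.cast_zero, add_zero]
      have h1 : (m - 1) ≠ 0 := hm1.ne'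
      have h2 : (m - 1 + θ + 1) ≠ 0 := by linarith
      field_simp
      ring
  · -- rows n ≥ 2
    obtain ⟨k, rfl⟩ : ∃ k, n = k + 2 := ⟨n - 2, by omega⟩
    have e1 : (k + 2 - 2 : ℕ) = k := by omega
    have e2 : (k + 2 - 1 : ℕ) = k + 1 := by omega
    rw [if_neg (by omega), if_neg (by omega), e1, e2]
    have hPp : 0 < ∏ i ∈ range k, (m + 1 + θ + (i : ℝ)) := HypergeomCM.prod_pos_of_pos _ (by linarith) k
    have hPq : 0 < ∏ i ∈ range k, (m + 1 + (i : ℝ)) := HypergeomCM.prod_pos_of_pos _ (by linarith) k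
    -- the three hypergeometric values at g = 1 through ω = (m+1+θ)_k/(m+1)_k
    have hQp : H (-θ) (m + 1) k = (∏ i ∈ range k, (m + 1 + θ + (i : ℝ))) / ∏ i ∈ range k, (m + 1 + (i : ℝ)) := by
      rw [hyp_one H hH k (-θ) (m + 1) (by linarith)]
      congr 1
      exact prod_congr rfl (fun i _ => by ring)
    have hQ0 : H (-θ) m (k + 1) = (m + θ) / m * ((∏ i ∈ range k, (m + 1 + θ + (i : ℝ))) / ∏ i ∈ range k, (m + 1 + (i : ℝ))) := by
      rw [hyp_one H hH (k + 1) (-θ) m hm0, HypergeomCM.prod_succ_shift, HypergeomCM.prod_succ_shift m k]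
      have e : ∏ i ∈ range k, (m - -θ + 1 + (i : ℝ)) = ∏ i ∈ range k, (m + 1 + θ + i) :=
        prod_congr rfl (fun i _ => by ring)
      rw [e]
      field_simp
      ring
    have hQm : H (-θ) (m - 1) (k + 2) = (m - 1 + θ) * (m + θ) / ((m - 1) * m) *
        ((∏ i ∈ range k, (m + 1 + θ + (i : ℝ))) / ∏ i ∈ range k, (m + 1 + (i : ℝ))) := by
      rw [hyp_one H hH (k + 2) (-θ) (m - 1) hm1, HypergeomCM.prod_succ_shift, HypergeomCM.prod_succ_shift (m - 1 - -θ + 1) k,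
        HypergeomCM.prod_succ_shift (m - 1) (k + 1), HypergeomCM.prod_succ_shift (m - 1 + 1) k]
      have e : ∏ i ∈ range k, (m - 1 - -θ + 1 + 1 + (i : ℝ)) = ∏ i ∈ range k, (m + 1 + θ + i) :=
        prod_congr rfl (fun i _ => by ring)
      have e' : ∏ i ∈ range k, (m - 1 + 1 + 1 + (i : ℝ)) = ∏ i ∈ range k, (m + 1 + i) :=
        prod_congr rfl (fun i _ => by ring)
      rw [e, e']
      field_simp
      ring
    rw [hQp, hQ0, hQm]
    push_cast
    field_simp
    ring

omit hH in
/-- Positivity of the row factors of `hypOne_row_eq`. -/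
theorem hypOne_row_factor_pos (θ m lam : ℝ) (hm : 1 < m) (hθ : 0 < θ) (hlam : 0 < lam) (n : ℕ) :
    0 < (if n = 0 then m * (m - 1) / (lam ^ 2 * (m - 1 + θ) * (m - 1 + θ + 1))
          else if n = 1 then m / (lam ^ 2 * (m - 1 + θ + 1))
          else (∏ i ∈ range (n - 2), (m + 1 + θ + (i : ℝ))) / ((∏ i ∈ range (n - 2), (m + 1 + (i : ℝ))) * lam ^ 2)) := by
  have hm1 : 0 < m - 1 := by linarith
  split_ifs
  · positivity
  · positivity
  · exact div_pos (HypergeomCM.prod_pos_of_pos _ (by linarith) _)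
      (mul_pos (HypergeomCM.prod_pos_of_pos _ (by linarith) _) (by positivity))

/-- **THEOREM N₃-II at `g = 1` in the vocabulary of `…LowerTailBandTwoHyp`** (`Q_c = ₂F₁(-θ,-·;c;1)`): for `θ > 0`,
`m > 1`, `λ > 0`, `g₁ > 0`, `0 < g₂ ≤ 1`, `w₁ > 0 > w₂ > -g₂λ` the three-ray band kernel at `g = 1` is totally nonnegative. -/
theorem threeRay_typeII_tn_hypOne (θ : ℝ) (hθ : 0 < θ) (m : ℝ) (hm : 1 < m) (lam : ℝ) (hlam : 0 < lam)
    (g₁ g₂ w₁ w₂ : ℝ) (hg₁ : 0 < g₁) (hg₂ : 0 < g₂) (hg₂' : g₂ ≤ 1) (hw₁ : 0 < w₁) (hw₂ : w₂ < 0)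
    (hb₂ : 0 < w₂ + g₂ * lam) {k : ℕ} (r c : Fin k → ℕ) (hr : StrictMono r) (hc : StrictMono c) :
    0 ≤ (Matrix.of fun i j =>
      (g₁ * g₂ * (r i : ℝ) * ((r i : ℝ) - 1) * H (-θ) (m + 1) (r i - 2)
        + m * (g₁ + g₂) * (r i : ℝ) * H (-θ) m (r i - 1)
        + m * (m - 1) * H (-θ) (m - 1) (r i)) * ((r i).choose (c j) : ℝ)
      + ((r i : ℝ) / lam * ((w₁ * g₂ + w₂ * g₁) * ((r i : ℝ) - 1) * H (-θ) (m + 1) (r i - 2)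
        + m * (w₁ + w₂) * H (-θ) m (r i - 1))) * (((r i) - 1).choose (c j) : ℝ)
      + ((r i : ℝ) * ((r i : ℝ) - 1) / lam ^ 2 * (w₁ * w₂) * H (-θ) (m + 1) (r i - 2))
        * (((r i) - 2).choose (c j) : ℝ)).det := by
  have hp : 0 < m - 1 + θ := by linarith
  let κ : ℕ → ℝ := fun n => if n = 0 then m * (m - 1) / (lam ^ 2 * (m - 1 + θ) * (m - 1 + θ + 1))
          else if n = 1 then m / (lam ^ 2 * (m - 1 + θ + 1))
          else (∏ i ∈ range (n - 2), (m + 1 + θ + (i : ℝ))) / ((∏ i ∈ range (n - 2), (m + 1 + (i : ℝ))) * lam ^ 2)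
  let K : ℕ → ℕ → ℝ := fun n l =>
    (lam ^ 2 * (g₁ * g₂ * (n : ℝ) * ((n : ℝ) - 1) + (g₁ + g₂) * ((m - 1 + θ) + 1) * (n : ℝ)
        + (m - 1 + θ) * ((m - 1 + θ) + 1))) * ((n.choose l : ℕ) : ℝ)
    + (lam * (n : ℝ) * ((w₁ * g₂ + w₂ * g₁) * ((n : ℝ) - 1) + (w₁ + w₂) * ((m - 1 + θ) + 1)))
        * (((n - 1).choose l : ℕ) : ℝ)
    + (w₁ * w₂ * (n : ℝ) * ((n : ℝ) - 1)) * (((n - 2).choose l : ℕ) : ℝ)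
  have hmat : (Matrix.of fun i j =>
      (g₁ * g₂ * (r i : ℝ) * ((r i : ℝ) - 1) * H (-θ) (m + 1) (r i - 2)
        + m * (g₁ + g₂) * (r i : ℝ) * H (-θ) m (r i - 1)
        + m * (m - 1) * H (-θ) (m - 1) (r i)) * ((r i).choose (c j) : ℝ)
      + ((r i : ℝ) / lam * ((w₁ * g₂ + w₂ * g₁) * ((r i : ℝ) - 1) * H (-θ) (m + 1) (r i - 2)
        + m * (w₁ + w₂) * H (-θ) m (r i - 1))) * (((r i) - 1).choose (c j) : ℝ)
      + ((r i : ℝ) * ((r i : ℝ) - 1) / lam ^ 2 * (w₁ * w₂) * H (-θ) (m + 1) (r i - 2))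
        * (((r i) - 2).choose (c j) : ℝ))
      = Matrix.of fun i j => κ (r i) * K (r i) (c j) * (fun _ : ℕ => (1 : ℝ)) (c j) := by
    ext i j
    simp only [Matrix.of_apply, mul_one]
    exact hypOne_row_eq H hH θ m lam g₁ g₂ w₁ w₂ hm hθ hlam (r i) (c j)
  rw [hmat, TNKernel.det_kernel_scale K κ (fun _ => (1 : ℝ)) r c]
  have hK := threeRay_typeII_tn_neutral lam (m - 1 + θ) g₁ g₂ w₁ w₂ hlam hp hg₁ hg₂ hg₂' hw₁ hw₂ hb₂ r c hr hc
  refine mul_nonneg (prod_pos fun i _ => hypOne_row_factor_pos θ m lam hm hθ hlam (r i)).le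
    (mul_nonneg (by simp) ?_)
  simpa [K] using hK

/-- **THEOREM N₃-III at `g = 1` in the vocabulary of `…LowerTailBandTwoHyp`**: for `θ > 0`, `m > 1`, `λ > 0`,
`0 ≤ g₁, g₂ ≤ 1`, `w₁, w₂ > 0` the three-ray band kernel at `g = 1` is totally nonnegative (the endpoint `g = 1` of
`threeRay_below_tn`). -/
theorem threeRay_typeIII_tn_hypOne (θ : ℝ) (hθ : 0 < θ) (m : ℝ) (hm : 1 < m) (lam : ℝ) (hlam : 0 < lam)
    (g₁ g₂ w₁ w₂ : ℝ) (hg₁ : 0 ≤ g₁) (hg₁' : g₁ ≤ 1) (hg₂ : 0 ≤ g₂) (hg₂' : g₂ ≤ 1) (hw₁ : 0 < w₁) (hw₂ : 0 < w₂)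
    {k : ℕ} (r c : Fin k → ℕ) (hr : StrictMono r) (hc : StrictMono c) :
    0 ≤ (Matrix.of fun i j =>
      (g₁ * g₂ * (r i : ℝ) * ((r i : ℝ) - 1) * H (-θ) (m + 1) (r i - 2)
        + m * (g₁ + g₂) * (r i : ℝ) * H (-θ) m (r i - 1)
        + m * (m - 1) * H (-θ) (m - 1) (r i)) * ((r i).choose (c j) : ℝ)
      + ((r i : ℝ) / lam * ((w₁ * g₂ + w₂ * g₁) * ((r i : ℝ) - 1) * H (-θ) (m + 1) (r i - 2)
        + m * (w₁ + w₂) * H (-θ) m (r i - 1))) * (((r i) - 1).choose (c j) : ℝ)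
      + ((r i : ℝ) * ((r i : ℝ) - 1) / lam ^ 2 * (w₁ * w₂) * H (-θ) (m + 1) (r i - 2))
        * (((r i) - 2).choose (c j) : ℝ)).det := by
  have hp : 0 < m - 1 + θ := by linarith
  let κ : ℕ → ℝ := fun n => if n = 0 then m * (m - 1) / (lam ^ 2 * (m - 1 + θ) * (m - 1 + θ + 1))
          else if n = 1 then m / (lam ^ 2 * (m - 1 + θ + 1))
          else (∏ i ∈ range (n - 2), (m + 1 + θ + (i : ℝ))) / ((∏ i ∈ range (n - 2), (m + 1 + (i : ℝ))) * lam ^ 2)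
  let K : ℕ → ℕ → ℝ := fun n l =>
    (lam ^ 2 * (g₁ * g₂ * (n : ℝ) * ((n : ℝ) - 1) + (g₁ + g₂) * ((m - 1 + θ) + 1) * (n : ℝ)
        + (m - 1 + θ) * ((m - 1 + θ) + 1))) * ((n.choose l : ℕ) : ℝ)
    + (lam * (n : ℝ) * ((w₁ * g₂ + w₂ * g₁) * ((n : ℝ) - 1) + (w₁ + w₂) * ((m - 1 + θ) + 1)))
        * (((n - 1).choose l : ℕ) : ℝ)
    + (w₁ * w₂ * (n : ℝ) * ((n : ℝ) - 1)) * (((n - 2).choose l : ℕ) : ℝ)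
  have hmat : (Matrix.of fun i j =>
      (g₁ * g₂ * (r i : ℝ) * ((r i : ℝ) - 1) * H (-θ) (m + 1) (r i - 2)
        + m * (g₁ + g₂) * (r i : ℝ) * H (-θ) m (r i - 1)
        + m * (m - 1) * H (-θ) (m - 1) (r i)) * ((r i).choose (c j) : ℝ)
      + ((r i : ℝ) / lam * ((w₁ * g₂ + w₂ * g₁) * ((r i : ℝ) - 1) * H (-θ) (m + 1) (r i - 2)
        + m * (w₁ + w₂) * H (-θ) m (r i - 1))) * (((r i) - 1).choose (c j) : ℝ)
      + ((r i : ℝ) * ((r i : ℝ) - 1) / lam ^ 2 * (w₁ * w₂) * H (-θ) (m + 1) (r i - 2))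
        * (((r i) - 2).choose (c j) : ℝ))
      = Matrix.of fun i j => κ (r i) * K (r i) (c j) * (fun _ : ℕ => (1 : ℝ)) (c j) := by
    ext i j
    simp only [Matrix.of_apply, mul_one]
    exact hypOne_row_eq H hH θ m lam g₁ g₂ w₁ w₂ hm hθ hlam (r i) (c j)
  rw [hmat, TNKernel.det_kernel_scale K κ (fun _ => (1 : ℝ)) r c]
  have hK := threeRay_typeIII_tn_neutral lam (m - 1 + θ) g₁ g₂ w₁ w₂ hlam hp hg₁ hg₁' hg₂ hg₂' hw₁ hw₂ r c hr hc
  refine mul_nonneg (prod_pos fun i _ => hypOne_row_factor_pos θ m lam hm hθ hlam (r i)).le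
    (mul_nonneg (by simp) ?_)
  simpa [K] using hK

end HypOne

end BandTwoNeutral

end Summit.CriticalPhenomena.PercolationContinuityZ3.Theorems
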